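import Literature.NumberTheory.EllipticCurves.CongruenceNumber
import Literature.NumberTheory.EllipticCurves.HeckeOperators
import HarnessLib
import HarnessLib.Audit.Tags

/-!
# 2-EISENSTEIN RANK ONE AT LEVEL `4p` — the typed candidate laws E-imc-81/82/83/85/86, the named implications
# E-imc-84/87, the kernel edge E-imc-89, the certificate vocabulary and E-imc-90 (imc g15, MEMO-imc §21; typing asks
# T-imc-8b (first cluster, p625117) and T-imc-8 (this append)) — cell `bsd-f2-manin` (D-0131 (3) frontier: the Manin
# constant at additive primes)

HONEST FRAMING.  LENS = IMC / Hecke-algebra multiplicity one at the Eisenstein prime `2` (planner-of-record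
`bsd-f2-manin-imc`, g15; HOME `run/shared/lean/pub/bsd-f2-manin/MEMO-imc.md` §21–§21.9).  Source: HOME/imc/Sketch-imc-g15.lean
sha16 **fc5ad09b67b83b19** (farm rc 0 · 0 errors · 0 warnings · 0 sorries; BC7 CLEAN g15-bc7.txt), namespace
`…Cruxes.ManinOddAtFour.TwoEisensteinRankOne` ↦ `…ManinAdditive.TwoEisenstein`; every declaration below is copied VERBATIM
(bodies byte-identical; route import `…Theses.ManinLocalTwoThree` dropped — unused), in the order §4 (first cluster, landed
2026-08-28T10:2xZ as p625117 on T-imc-8b) then §§1–3, the rest of §4, §5 (this append, T-imc-8, filed after refuter-1's audit).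
One addition that is not imc's: `FamilyHeckeInputs` = refuter-1's RB66.4 (REF1 §R58), the schema NAMING the four E-side inputs
that turn the general certificate theorem E-imc-90 into the family implication E-imc-84 (VERBATIM from
HOME/ref1-C66-imc-g15-audit.lean 5a8e74af0c7f63eb).  Nothing in this file is asserted: the `@[conjecture]` rows are
STATEMENTS (cell candidates, NOT tree facts), the two plain implication `def`s are THEOREM-candidates, the one `theorem` is
a kernel-checked edge over the named ARS fact.

THE LENS READING (imc, Sketch-imc-g15 header, abridged).  For a maximal ideal `𝔪 ∋ 2` of the Hecke algebra
`𝕋 ⊂ End S₂(Γ₀(N); ℤ)` which is EISENSTEIN (`T_ℓ ≡ 1 + ℓ ≡ 0 (mod 𝔪)` for all odd primes `ℓ ∤ N`), the `𝔪`-adic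
generalized eigenspace of `S₂(Γ₀(N); ℤ) ⊗ ℤ₂` is free of rank `rank_{ℤ₂} 𝕋_𝔪 = Σ_{(g,λ)} [K_{g,λ} : ℚ₂]` over the
2-EISENSTEIN (eigen-packet, prime `λ ∣ 2`) pairs (old packets counted with multiplicity).  Mod 2 this eigenspace is the
space of `T_ℓ`-NILPOTENT vectors of `S₂(Γ₀(N); 𝔽₂)` (`IsTwoEisensteinNilpotent`), so «`rank_{ℤ₂} 𝕋_𝔪 = 1`» is the
elementary statement «the nilpotent vectors form a LINE» (`FourPTwoEisensteinRankOne`, E-imc-85).  Rank one at `𝔪 ∋ f`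
IMPLIES «`r_f` odd» for a rational 2-Eisenstein newform `f` (E-imc-87; refuter-1 F-7: only this direction holds in
general), and at `N = 4p`, `p ≡ 5 (mod 8)`, the rational 2-Eisenstein newforms are exactly the `f_{E'_m}`, `p = m² + 4`
(Ivorra 2004 via Yazdani §3.4–3.5, row E-imc-80, in print).  So the chain is `FourPTwoEisensteinRankOne ⟹
FourPFamilyCongruenceOdd (= Yazdani's printed open expectation, E-imc-82) ⟹ (ARS, E-imc-89) odd optimal degree ⟹ (ČNS
Thm 1.2, ε₂(4p) = 0; an's row E-an-74 `OddDegreeTooth.FourPBlindFamilyOddDegree` and an's ČNS edge, Sketch-an-g17) 2 ∤ c₀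
⟹ (Mazur 1978 at p ∥ N) |c₀| = 1` on the ENTIRE blind tame family `RbTotallyBlindTame` of C2 — and the first statement mentions no elliptic
curve, no Manin constant, no modular degree.  The CERTIFICATE road (§4) is the decidable per-level twin: E-imc-83 (a 2-adic
isolation certificate at every family level) ⟹ E-imc-84 ⟹ E-imc-82, where E-imc-84 is E-imc-90 (now a THEOREM) plus the
four E-side inputs `FamilyHeckeInputs`.

STATUS OF E-imc-90 (update to the first cluster's docstring): **THEOREM** —
`Summit.BirchSwinnertonDyer.BirchSwinnertonDyer.Theorems.ManinLocalTwoThree.OddCongruenceNumberOfIsolationCertificate_holds`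
(p626649, `Theorems/ManinLocalTwoThreeOddCongruenceNumber.lean`, bsd-line-manin23-p3 2026-08-28T10:56:13Z; algebraic halves
p625050 `…ModTwoIsolation`); refuter-1 §R58 F-2 confirmed beforehand that no extra `r_f ≠ 0` hypothesis is needed (the
certificate makes the eigenvalue `a` SIMPLE, RB66.10).

BC5 WITNESS (imc census, kit tag bsd; engine 1 = PARI newform packets + primes over 2, HOME/imc/g15-eis2.gp bffa6ccb0a7917dc,
jobs j304256/j304335/j304914/j305095/j305128; tables HOME/imc/g15-eis2-full.tsv ca6bb8253a9bde5d, g15-eis2-newonly-table.txt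
d5a42e2a96e2a838, summary g15-eis2-summary.txt 4502b08414cf8498, evidence on stmt-BirchSwinnertonDyer-22967; FINAL-FOR-SESSION
MEMO-imc §21.9): 144 levels `4p`-new, **0 violations** — `p ≡ 5 (mod 8)`: 59/59 (`p ≤ 1429`) rank one (one (packet, λ),
`f = e = 1`; family `p = 5, 13, 29, 53, 173, 229, 293` where the packet is `f_{E'_m}`, non-family `p = 37, 61, 101, 109,
149, …` where it is a NON-rational packet of degree `2, 4, 7, 4, 10, …`); `p ≡ 1 (mod 8)`: 52/52 (`p ≤ 1433`) with
`e = (h(−4p))₂/2` (E-imc-88, prose law, not typed); `p ≡ 3, 7 (mod 8)`: 33/33 none; old parts: 43/43 nothing at `p`, `2p`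
for `p ≡ ±3 (mod 8)`.  ENGINE 2 (refuter-1 §R58 §4, weight-2 modular symbols over ℚ with exact integer charpolys,
HOME/ref1/e58/R58-msym.py 0e0e677e3a214873, validated 24/24 on ecdata): imc's packet census reproduced at 73/73 level-parts
(`p ≤ 113`); E-81 certified 16/16, E-85 `R(4p) ≤ 1` certified 8/8, E-86 `R(4p) = 0` certified 7/7, E-88 29/29; E-83
certificates `(N, ℓ, a_ℓ) = (20,3,−2) (52,3,0) (116,3,2) (212,17,2) (692,41,10) (916,17,−2) (1172,23,6)` — all seven family
levels computed, the last one NEW (engine 2 only).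

REFUTER VERDICTS.  refuter-1 §R58 (R-imc-33, 2026-08-28T10:55Z; HOME/ref1/R58-ref1-imc-g15.md aa26f61ef203f04d; kernel
read-back HOME/ref1-C66-imc-g15-audit.lean 5a8e74af0c7f63eb rc 0 · 0/0/0, axioms standard; BC7 HOME/ref1/R58-PH.out
24959e7e3545c461 10/10 CLEAN): **11/11 SURVIVE, 0 KILLED, 0 mis-typed** (E-imc-81/82/83/84/85/86/87/88/89/90 + 85ᵀ/85U);
findings F-1 (E-85 ⟺ `rank_ℤ₂ S_𝔪 = 1`, old forms INCLUDED; `n = 0` admissible in `IsTwoEisensteinNilpotent`, intended), F-3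
(E-83's certificate lives on the FULL cusp space), F-4 (E-87's proof sketch correct, inputs = `FamilyHeckeInputs`), F-7
(«equivalent» → «implies»).  refuter-2 R-imc-34 (placement) PENDING at filing.  PLACEMENT (imc + refuter-1 presearch, corpus
fts+vec + galaxy): the `(ℓ = 2, level 4p)` rank law is NOT in print — nearest Calegari–Emerton 2005 Thm 1.1 (prime level
`N ≡ 9 (16)`), Kedlaya–Medvedovsky (1red), Yoo 2019/2023 Thm 3.18 (existence side in cuspidal-group currency), Martin 2017
(squarefree); E-imc-82 is in print as an EXPECTATION (Yazdani, after Thm 3.8).  bears_on: stmt-BirchSwinnertonDyer-22967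
(C2 `ManinOddAtFour`, stub 6 `R♭`, component `RbTotallyBlindTame`; crux idea `two-eisenstein-rank-one`, commit 1dcc86cce347).
PARTITION 0 · beyond-print theorem: no · BSD is not proved by this; Manin's conjecture is not proved by this.
-/

set_option autoImplicit false

noncomputable section

open scoped MatrixGroups
open CongruenceSubgroup
open Literature.NumberTheory.EllipticCurves Literature.NumberTheory.EllipticCurves.ModularForms

namespace Summit.BirchSwinnertonDyer.Rank1Residual.ManinAdditive.TwoEisenstein

/-- **2-adic isolation certificate at `ℓ`** for an integral eigenvalue `a = a_ℓ(f)`: the characteristic value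
`det((1 + ℓ) − T_ℓ | S₂(Γ₀(N)))` (`= #J₀(N)(𝔽_ℓ)` by Eichler–Shimura) is a non-zero integer with the SAME 2-adic
valuation as `1 + ℓ − a` (`= #E(𝔽_ℓ)` for the curve of `f`).  Since every 2-Eisenstein pair `(g, λ) ≠ (f, ·)` contributes
`f_λ · v_λ(1 + ℓ − a_ℓ(g)) ≥ 1` to `v₂(det)`, the certificate forces `f` to be the ONLY 2-Eisenstein pair: `𝕋_𝔪 = ℤ₂`.
(imc g15 VERBATIM, Sketch-imc-g15.lean :159–162.) -/
def TwoAdicIsolationCertificate (N ℓ : ℕ) [NeZero N] [NeZero ℓ] (a : ℤ) : Prop :=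
  ∃ z : ℤ, z ≠ 0 ∧
    (z : ℂ) = LinearMap.det (((1 : ℂ) + ℓ) • (1 : Module.End ℂ (CuspForm (Gamma0 N) 2)) - heckeT (Gamma0 N) 2 ℓ) ∧
      padicValInt 2 z = padicValInt 2 (1 + ℓ - a)

/-- **Candidate E-imc-90 `OddCongruenceNumberOfIsolationCertificate` (GENERAL FORM of E-imc-84; THEOREM-candidate,
elementary — proof HOME/imc/g15-E84-proof.md; cell bsd-f2-manin, imc g15; nothing asserted here):** for a normalised
integral Hecke eigenform `f` on `Γ₀(N)` with EVEN eigenvalue `a` at an odd prime `ℓ ∤ N`, a 2-adic isolation certificate at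
`ℓ` forces the congruence number `r_f` (tree `congruenceNumber`, the index `#(S(ℤ) ⧸ (ℤf ⊕ (ℤf)^⊥))`) to be ODD.  Proof:
`det((1+ℓ) − T_ℓ | S₂) = (1+ℓ−a)·det((1+ℓ) − T_ℓ | (ℤf)^⊥)`, so the certificate makes `T_ℓ` bijective on `(ℤf)^⊥/2`; an
element of order 2 in `S(ℤ)/(ℤf ⊕ (ℤf)^⊥)` gives `g ∈ (ℤf)^⊥` with `g ≡ f (mod 2)`, then `T_ℓ g ≡ a f ≡ 0`, so `g ∈ 2(ℤf)^⊥`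
and `f ∈ 2S(ℤ)`, contradicting `a₁(f) = 1`.  Level-free and curve-free; E-imc-84 is the instance `N = 4p`, `f = f_{E'_m}`
(where `2 ∣ a_ℓ` is the rational 2-torsion parity).  Kernel-checked halves E-imc-90a / 90b (imc; landing by p3); Theorems
target `OddCongruenceNumberOfIsolationCertificate_holds` — UPDATE 2026-08-28T10:56Z: PROVED, p626649
`…Theorems.ManinLocalTwoThree.OddCongruenceNumberOfIsolationCertificate_holds` (bsd-line-manin23-p3); refuter-1 §R58: SURVIVES,
F-2 (no extra `r_f ≠ 0` hypothesis needed).  (imc g15 VERBATIM, Sketch-imc-g15.lean :192–198.)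
[cite: AgasheRibetStein2012, §3 and Lemma 5.8 (shape only: congruence primes = non-isolation of `f` in the Hecke algebra; the single-operator 2-adic certificate form is folklore-grade, MEMO-imc §21.9 — not printed as stated)] -/
@[conjecture]
def OddCongruenceNumberOfIsolationCertificate : Prop :=
  ∀ (N : ℕ) [NeZero N] (ℓ : ℕ) (hℓ : ℓ.Prime) (f : CuspForm (Gamma0 N) 2) (a : ℤ),
    Odd ℓ → ¬ ℓ ∣ N → f ∈ integralCuspForms0 N 2 → cuspCoeff f 1 = 1 →
      (haveI : NeZero ℓ := ⟨hℓ.ne_zero⟩; heckeT (Gamma0 N) 2 ℓ) f = (a : ℂ) • f → (2 : ℤ) ∣ a →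
        (haveI : NeZero ℓ := ⟨hℓ.ne_zero⟩; TwoAdicIsolationCertificate N ℓ a) →
          Odd (congruenceNumber f)

/-! ### §1. Mod-2 vocabulary on `S₂(Γ₀(N); ℤ)` (imc g15 VERBATIM, Sketch-imc-g15.lean :58–70) -/

/-- `g ∈ 2 · S₂(Γ₀(N); ℤ)`: `g` is twice an integral cusp form (i.e. `g ≡ 0 (mod 2)` coefficientwise).
(imc g15 VERBATIM; refuter-1 RB66.2: the zero form is twice-integral.) -/
def IsTwiceIntegral (N : ℕ) (g : CuspForm (Gamma0 N) 2) : Prop :=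
  ∃ h ∈ integralCuspForms0 N 2, g = (2 : ℂ) • h

/-- **2-Eisenstein-nilpotent integral form.**  `g ∈ S₂(Γ₀(N); ℤ)` and, for every odd prime `ℓ ∤ N`, some power of
`T_ℓ` maps `g` into `2 · S₂(Γ₀(N); ℤ)`.  Since `1 + ℓ ≡ 0 (mod 2)`, this says that the reduction `ḡ ∈ S₂(Γ₀(N); 𝔽₂)`
lies in the generalized eigenspace of the EISENSTEIN eigensystem `a_ℓ ≡ 1 + ℓ`; the set of such `g` is
`2·S₂(ℤ) + (S₂(ℤ) ⊗ ℤ₂)_𝔪 ∩ S₂(ℤ)`, and its image in `S₂(ℤ)/2` is an `𝔽₂`-space of dimension `rank_{ℤ₂} 𝕋_𝔪`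
(`0` if there is no 2-Eisenstein maximal ideal).  (imc g15 VERBATIM.  refuter-1 §R58 F-1: ⟺ `ḡ` lies in
`(S(ℤ) ⊗ ℤ₂)_𝔪 ⊗ 𝔽₂` for the ANEMIC `𝔪 = (2, T_ℓ − 1 − ℓ)`, old forms INCLUDED; RB66.1: `n = 0` is admissible, so every
twice-integral integral form is nilpotent — intended, the laws are about the image in `S₂(ℤ)/2`.) -/
def IsTwoEisensteinNilpotent (N : ℕ) [NeZero N] (g : CuspForm (Gamma0 N) 2) : Prop :=
  g ∈ integralCuspForms0 N 2 ∧
    ∀ (ℓ : ℕ) (hℓ : ℓ.Prime), Odd ℓ → ¬ ℓ ∣ N →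
      ∃ n : ℕ, IsTwiceIntegral N (((haveI : NeZero ℓ := ⟨hℓ.ne_zero⟩; heckeT (Gamma0 N) 2 ℓ) ^ n) g)

/-! ### §2. The census laws at the Eisenstein prime 2 (statements; nothing asserted; imc g15 VERBATIM :74–112) -/

/-- **Candidate E-imc-85 `FourPTwoEisensteinRankOne` (LAW, `c`-free, `E`-free; the deciding statement of the lens;
cell bsd-f2-manin, imc g15; nothing asserted).**  For a prime `p ≡ 5 (mod 8)` the 2-Eisenstein-nilpotent vectors of
`S₂(Γ₀(4p); 𝔽₂)` form a LINE: there is an integral form `g₀`, not `≡ 0 (mod 2)`, 2-Eisenstein-nilpotent, and every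
2-Eisenstein-nilpotent integral form is `≡ 0` or `≡ g₀ (mod 2)`.  Equivalently `𝕋(Γ₀(4p))` has exactly one Eisenstein
maximal ideal `𝔪 ∋ 2` and `𝕋_𝔪 = ℤ₂` (one 2-Eisenstein newform packet, one prime `λ ∣ 2` over it, `f_λ = e_λ = 1`, and no
2-Eisenstein old forms — level `p`: Mazur, `p ≢ 1 (mod 8)`; level `2p`: `TwoPNoTwoEisenstein`).  BC5 (imc, FINAL-FOR-SESSION
MEMO-imc §21.9): **59/59** levels `4p`, `p ≡ 5 (mod 8)`, `p ≤ 1429`, rank one, 0 violations — family `p = 5, 13, 29, 53,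
173, 229, 293` (the packet is `f_{E'_m}`), non-family `p = 37, 61, 101, 109, 149, 157, 181, 197, …` (a non-rational
packet); engine 2 (refuter-1, modular symbols): `R(4p) = 3R(p) + 2R_new(2p) + R_new(4p) ≤ 1` CERTIFIED part-wise at
`p = 5, 13, 29, 37, 53, 61, 101, 109` (8/8) and `= 1` exactly at all seven family levels.  Why it might fail: a second
2-Eisenstein newform packet at some larger `4p` (e.g. a level-raised congruence), or a ramified `λ` (`e_λ = 2`) — at
`p ≡ 1 (mod 8)` the unique new pair IS ramified, `e_λ = 2^{v₂(h(−4p))−1} ≥ 2`, so the law leans on `h(−4p) ≡ 2 (mod 4)`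
for `p ≡ 5 (mod 8)` (genus theory + Rédei); mutation check (refuter-1): dropping `p % 8 = 5` fails at once (`R(68) = 7`,
`R(164) = 19`).  NOT IN PRINT: the `(ℓ = 2, level 4p)` rank law; nearest Calegari–Emerton 2005 Thm 1.1 (prime level
`N ≡ 9 (16)`: `e_f = 2^{m−1} − 1`, `2^m ∥ h(−N)`).  REF1 §R58 (R-imc-33): **SURVIVES** (LAW alive; BC7 CLEAN); Hecke-algebra
twin E-imc-85ᵀ (`𝕋_{𝔪₂} = ℤ₂`, imc SketchU) is implied by this row (faithfulness), converse automatic on `p ≡ 5 (mod 8)`.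
[conjecture — cell candidate, NOT a tree fact]
[cite: CalegariEmerton2005, Thm. 1.1 (shape only: the prime-level `N ≡ 9 (mod 16)` ramification law at the Eisenstein prime 2; the level-`4p` rank-one law is the cell's row E-imc-85, NOT in print — MEMO-imc §21)] -/
@[conjecture]
def FourPTwoEisensteinRankOne : Prop :=
  ∀ (p : ℕ) [NeZero (4 * p)], p.Prime → p % 8 = 5 →
    ∃ g₀ : CuspForm (Gamma0 (4 * p)) 2,
      IsTwoEisensteinNilpotent (4 * p) g₀ ∧ ¬ IsTwiceIntegral (4 * p) g₀ ∧
        ∀ g : CuspForm (Gamma0 (4 * p)) 2, IsTwoEisensteinNilpotent (4 * p) g →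
          IsTwiceIntegral (4 * p) g ∨ IsTwiceIntegral (4 * p) (g - g₀)

/-- **Candidate E-imc-86 `FourPNoTwoEisensteinThreeModEight` (LAW, control statement; imc g15; nothing asserted).**  For
a prime `p ≡ 3 (mod 8)` there is NO 2-Eisenstein congruence in `S₂(Γ₀(4p))` at all: every 2-Eisenstein-nilpotent integral
form is `≡ 0 (mod 2)` (equivalently `#J₀(4p)(𝔽_ℓ)` is odd for some, in fact for a positive density of, primes `ℓ`).  BC5
(imc): 33/33 levels `p ≡ 3 (mod 4)`, `p ≤ 787`: no new pair; `u₂(4p) = 0` certified 11/11 (`p ≡ 3 (mod 8)`, `p = 11, 19,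
43, 59, 67, 83, 107, 131, 139, 163, 179`); engine 2 (refuter-1): `R(4p) = 0` CERTIFIED at `p = 11, 19, 43, 59, 67, 83,
107` (7/7); `p = 3`: `S₂(12) = 0`, trivially true (harmless).  Why it might fail: a sporadic Eisenstein congruence at large
`p ≡ 3 (mod 8)` from a ramified `λ`.  refuter-1 RB66.3: at one level this shape and the existence half of E-imc-85's
shape are mutually exclusive.  REF1 §R58: **SURVIVES** (LAW; certified instances).
[conjecture — cell candidate, NOT a tree fact]
[cite: CalegariEmerton2005, Thm. 1.1 (shape only: prime level; the level-`4p` control law is the cell's row E-imc-86, NOT in print)] -/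
@[conjecture]
def FourPNoTwoEisensteinThreeModEight : Prop :=
  ∀ (p : ℕ) [NeZero (4 * p)], p.Prime → p % 8 = 3 →
    ∀ g : CuspForm (Gamma0 (4 * p)) 2, IsTwoEisensteinNilpotent (4 * p) g → IsTwiceIntegral (4 * p) g

/-- **Candidate E-imc-81 `TwoPNoTwoEisenstein` (LAW; the level-`2p` input of isolation; imc g15; nothing asserted).**  For
a prime `p ≡ ±3 (mod 8)` there is no 2-Eisenstein congruence in `S₂(Γ₀(2p))`: every 2-Eisenstein-nilpotent integral form
is `≡ 0 (mod 2)`.  Consistent with PRINT: the cyclic cuspidal group `C_{2p} = ⟨(0) − (∞)⟩` has order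
`(p² − 1)/(8·gcd(3, p + 1))` (Yoo, Thm 3.18), odd iff `p ≡ ±3 (mod 8)`; and no curve of conductor `2p`, `p ≥ 29`, has a
rational 2-torsion point unless `p ± 2^k` or `2^k − p` is a square, `k ≥ 4`, forcing `p ≡ ±1 (mod 8)` (Ivorra 2004).  The
Hecke-side statement at `ℓ = 2` (no 2-Eisenstein maximal ideal) is not in print (Ohta 2014 / Yoo exclude `ℓ = 2`).  BC5
(imc): 26/26 levels `2p`, `p ≡ ±3 (mod 8)`, `p ≤ 199` (+ the `2p`-old rows of the 45 levels `4p`): zero pairs,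
`u₂(2p) = 0`; engine 2 (refuter-1): `R(2p) = 0` CERTIFIED at all 16 primes `p ≡ ±3 (mod 8)`, `3 ≤ p ≤ 109`; controls
`p ≡ ±1 (mod 8)`: `R_new(2p) ∈ {1, 3, 5, 7, 9, 15}`, never `0` (13/13), and NOT a function of `h(−4p)`.  `p = 3, 5`:
`S₂(6) = S₂(10) = 0`, degenerate-true (harmless).  REF1 §R58: **SURVIVES** (LAW alive, 0 violations).
[conjecture — cell candidate, NOT a tree fact]
[cite: Yoo2019, Thm. 3.18 (shape only: the order of the rational cuspidal divisor class group of `X₀(2p)`, odd iff `p ≡ ±3 (mod 8)`; the Hecke-side `ℓ = 2` statement is the cell's row E-imc-81, NOT in print)] -/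
@[conjecture]
def TwoPNoTwoEisenstein : Prop :=
  ∀ (p : ℕ) [NeZero (2 * p)], p.Prime → (p % 8 = 3 ∨ p % 8 = 5) →
    ∀ g : CuspForm (Gamma0 (2 * p)) 2, IsTwoEisensteinNilpotent (2 * p) g → IsTwiceIntegral (2 * p) g

/-! ### §3. The family form: Yazdani's expectation, typed (imc g15 VERBATIM :116–151) -/

/-- **Candidate E-imc-82 `FourPFamilyCongruenceOdd` (= Yazdani, after Thm 3.8: «we expect that all of these elliptic curves
have odd congruence numbers … we do not yet know of a proof», typed for the `4p` family; `c`-free, optimality-free — `r_f`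
depends on the newform only; imc g15; nothing asserted).**  For `m ≡ 1 (mod 4)` with `p = m² + 4` prime, the newform of
`E'_m : y² = x³ − 2m x² + p x` at level `4p` has ODD congruence number.  BC5: `r_f = 1, 3, 15, 21, 123, 153, 345` at
`N = 20, 52, 116, 212, 692, 916, 1172` (-data CONGNUM-N1500-rows-v1.tsv) `= deg φ₀`; second engine: the isolation
certificate at the same seven levels (§4; refuter-1 engine 2 adds `(1172, 23, 6)`), which with E-imc-90 (THEOREM p626649)
and `FamilyHeckeInputs` PROVES the instance.  Why it might fail: an even `r_f` at a larger family level (a congruence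
`f ≡ g (mod λ)`, `λ ∣ 2`, with a non-rational newform `g`) — exactly a failure of `FourPTwoEisensteinRankOne`.  refuter-1
F-5: the interface `ModularParametrizationData ⟨0,−2m,0,p,0⟩ (4p)` has no tree inhabitant (modularity), so the row is not
provable by instances, but it is not vacuous in the bad sense; F-6: `Int.emod` makes `m = …, −7, −3, 1, 5, 9, 13, …` the
intended enumeration.  REF1 §R58: **SURVIVES** (printed EXPECTATION typed faithfully).
[conjecture — cell candidate, NOT a tree fact]
[cite: Yazdani2009, Thm. 3.8 and the paragraph following it (the odd-congruence-number expectation for the curves `E'_m`, stated without proof)] -/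
@[conjecture]
def FourPFamilyCongruenceOdd : Prop :=
  ∀ (m : ℤ) (p : ℕ) [NeZero (4 * p)]
    (D : ModularParametrizationData (⟨0, -2 * (m : ℚ), 0, (p : ℚ), 0⟩ : WeierstrassCurve ℚ) (4 * p)),
    m % 4 = 1 → (p : ℤ) = m ^ 2 + 4 → p.Prime → Odd (congruenceNumber D.f)

/-- **E-imc-87 `RankOneForcesOddCongruence` (named implication, THEOREM-candidate in standard commutative algebra; NOT
kernel-proved here; imc g15 VERBATIM).**  Rank one forces odd congruence number: `f = D.f ∈ S₂(Γ₀(4p); ℤ)` is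
2-Eisenstein-nilpotent (`a_ℓ(f) = 1 + ℓ − #E'_m(𝔽_ℓ)` is even because `E'_m(ℚ) ⊇ ℤ/2` injects into `E'_m(𝔽_ℓ)`),
`f ≢ 0 (mod 2)` (`a₁ = 1`), so under `FourPTwoEisensteinRankOne` the 2-adic Eisenstein eigenspace is `ℤ₂ f`,
`S₂(ℤ) ⊗ ℤ₂ = ℤ₂ f ⊕ ((ℤf)^⊥ ⊗ ℤ₂)` by the idempotent of `𝕋 ⊗ ℤ₂ = ℤ₂ × 𝕋'`, and the congruence module
`S₂(ℤ)/(ℤf + (ℤf)^⊥)` has odd order.  Needs in the tree: the perfect pairing `S₂(Γ₀(N); ℤ) × 𝕋 → ℤ` (cf.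
`DeligneSerreSpanHeckeDualityProofs`) and `a_ℓ(D.f) = ℓ + 1 − #W(𝔽_ℓ)`.  refuter-1 §R58 F-4: the proof sketch (idempotent
`e_𝔪 ∈ 𝕋^an ⊗ ℤ₂` by `finite_heckeRing0`, `S_𝔪 = ℤ₂ f`, `(1 − e_𝔪)S = (ℤf)^⊥ ⊗ ℤ₂` via `φ_f = ⟨f,·⟩/⟨f,f⟩` and
`heckeT_selfAdjoint`) is correct and needs exactly the four `FamilyHeckeInputs`; F-7: rank one IMPLIES `r_f` odd, the
converse need not hold (a second `𝔪`-form may differ from `f` at `U₂`, `U_p`).  REF1 §R58: **SURVIVES** (THEOREM-candidate,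
prover-sized (M); target name `rankOneForcesOddCongruence_holds`). -/
def RankOneForcesOddCongruence : Prop :=
  FourPTwoEisensteinRankOne → FourPFamilyCongruenceOdd

/-- **E-imc-89 — EDGE (kernel-checked; imc g15 VERBATIM): odd congruence number ⟹ odd OPTIMAL modular degree**, modulo
the printed ARS Thm 2.1 (`modularDegree_dvd_congruenceNumber`, statement-only fact used BY NAME), for every degree-minimal
datum of `E'_m` at level `4p` — i.e. E-imc-82 feeds the parity law E-an-74 (`OddDegreeTooth.FourPBlindFamilyOddDegree`) and
E-imc-28 and hence, via ČNS Thm 1.2 (`ε₂(4p) = 0`), C2 on the blind tame family (an's ČNS edge, Sketch-an-g17).  refuter-1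
§R58: PROVED (sketch) re-checked, axioms `[propext, Classical.choice, Quot.sound]`; `hmin` (degree-minimality) is a genuine
hypothesis of the tree's ARS fact.
[cite: AgasheRibetStein2012, Thm. 2.1 (a) (`deg φ ∣ r_f` for the optimal quotient; used by name, statement-only in the tree)] -/
theorem odd_modularDegree_of_congruenceOdd (h82 : FourPFamilyCongruenceOdd)
    (hARS : modularDegree_dvd_congruenceNumber) (m : ℤ) (p : ℕ) [NeZero (4 * p)]
    [(⟨0, -2 * (m : ℚ), 0, (p : ℚ), 0⟩ : WeierstrassCurve ℚ).IsElliptic]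
    (D : ModularParametrizationData (⟨0, -2 * (m : ℚ), 0, (p : ℚ), 0⟩ : WeierstrassCurve ℚ) (4 * p))
    (hm : m % 4 = 1) (hp : (p : ℤ) = m ^ 2 + 4) (hpp : p.Prime)
    (hmin : ∀ (W' : WeierstrassCurve ℚ) [W'.IsElliptic] (D' : ModularParametrizationData W' (4 * p)),
      D'.f = D.f → D.modularDegree ≤ D'.modularDegree) :
    Odd D.modularDegree :=
  Odd.of_dvd_nat (h82 m p D hm hp hpp) (hARS _ (4 * p) D hmin)

/-! ### §4 (continued). The certificate form on the family (imc g15 VERBATIM :164–182) and refuter-1's input schema -/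

/-- **Candidate E-imc-83 `FourPFamilyIsolationCertified` (certificate form of isolation on the family; `c`-free; imc g15;
nothing asserted).**  For every family level some odd prime `ℓ ≠ p` certifies isolation (`TwoAdicIsolationCertificate`, first
cluster above: `det((1 + ℓ) − T_ℓ | S₂(Γ₀(4p)))` is a non-zero integer with the same 2-adic valuation as `1 + ℓ − a_ℓ`).
The certificate is taken on the FULL cusp space `S₂(Γ₀(4p))` (`LinearMap.det` over `CuspForm (Gamma0 (4p)) 2`, old forms
INCLUDED — refuter-1 F-3/H-3: it is equivalent to `r_ℓ(4p) = 1`, i.e. ONE `ℓ` separates all non-Eisenstein systems at once;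
that is why the certifying prime at `N = 212` is `ℓ = 17` although the `4p`-new part is isolated at `ℓ = 3` already).
BC5 (two engines, imc PARI j304335/j304914 + refuter-1 modular symbols): certificates at `(N, ℓ, a_ℓ) = (20,3,−2) (52,3,0)
(116,3,2) (212,17,2) (692,41,10) (916,17,−2) (1172,23,6)` — all seven family levels `N < 1500`, the last by engine 2 only
(imc's row 1172 has no `liso`); `u₂ = 1, 1, 1, 1, 5, 2, 1`.  Why it might fail even if `FourPTwoEisensteinRankOne` holds:
the admissible `ℓ` are cut out by simultaneous Chebotarev conditions (for `h(m² + 4) > 1`, i.e. all `m > 17` by Biró 2003,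
the dihedral packets `Ind_{ℚ(√p)} ψ` of level `p` force `ℓ` to split in `ℚ(√p)`, so `v₂(#E'_m(𝔽_ℓ)) ≥ 2` at every
certifying `ℓ` — observed at `N = 916`: `u₂ = 2`, certificate at `ℓ = 17`); a level where the conditions are incompatible
would break 83 but not 85.  Corner `a = 1 + ℓ` (junk `padicValInt 2 0 = 0`, RB66.8) is unsatisfiable together with
`z ≠ 0 ∧ z = det` (then `det = 0`).  REF1 §R58: **SURVIVES** (LAW; decidable per level; implies E-imc-82 via E-imc-84).
[conjecture — cell candidate, NOT a tree fact]
[cite: AgasheRibetStein2012, §3 and Lemma 5.8 (shape only: congruence primes = non-isolation of `f` in the Hecke algebra; the per-level 2-adic certificate law on the family is the cell's row E-imc-83, NOT in print)] -/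
@[conjecture]
def FourPFamilyIsolationCertified : Prop :=
  ∀ (m : ℤ) (p : ℕ) [NeZero (4 * p)]
    (D : ModularParametrizationData (⟨0, -2 * (m : ℚ), 0, (p : ℚ), 0⟩ : WeierstrassCurve ℚ) (4 * p)),
    m % 4 = 1 → (p : ℤ) = m ^ 2 + 4 → p.Prime →
      ∃ (ℓ : ℕ) (hℓ : ℓ.Prime) (a : ℤ), Odd ℓ ∧ ℓ ≠ p ∧ (a : ℂ) = cuspCoeff D.f ℓ ∧
        (haveI : NeZero ℓ := ⟨hℓ.ne_zero⟩; TwoAdicIsolationCertificate (4 * p) ℓ a)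

/-- **E-imc-84 `IsolationCertificateForcesOddCongruence` (named implication, THEOREM-candidate; NOT kernel-proved here;
imc g15 VERBATIM):** a certificate at one `ℓ` forces `r_f` odd (valuation count over 2-Eisenstein pairs + the duality
argument of E-imc-87).  UPDATE at filing: E-imc-90 is a THEOREM (p626649
`…Theorems.ManinLocalTwoThree.OddCongruenceNumberOfIsolationCertificate_holds`), so by refuter-1 RB66.5 this row follows from
`FamilyHeckeInputs` alone (kernel edge `isolationCertificateForcesOddCongruence_of_familyHeckeInputs` in the sibling
`TwoEisensteinRankOneLawsEdges.lean`).  REF1 §R58: **SURVIVES** (THEOREM-candidate; inputs named). -/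
def IsolationCertificateForcesOddCongruence : Prop :=
  FourPFamilyIsolationCertified → FourPFamilyCongruenceOdd

/-- **`FamilyHeckeInputs` — the E-side inputs of E-imc-84 (refuter-1 §R58 RB66.4 VERBATIM, `RefAudit66.FamilyHeckeInputs`;
a THEOREM-expected schema, NOT a law and NOT asserted).**  For the family datum `D` at level `4p` and a prime `ℓ` as in
E-imc-83: `D.f ∈ S₂(ℤ)`, `a₁(D.f) = 1`, the Hecke eigen-relation `T_ℓ D.f = a_ℓ • D.f`, and the parity `2 ∣ a_ℓ` (rational
2-torsion of `E'_m` injects into `E'_m(𝔽_ℓ)`; `Δ(E'_m) = −256 p²`, so every odd `ℓ ≠ p` is good).  Stated as a hypothesis: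
it is what `IsNewformOf` (`D.isNewformOf : IsNewform0 D.f ∧ ∀ n, aₙ(D.f) = aₙ(W)`, tree
`ModularParametrizationData.f_mem_integralCuspForms0`) plus the point-count formula `a_ℓ(W) = ℓ + 1 − #W(𝔽_ℓ)` must
deliver in the tree; refuter-1 does not assert it and neither does this file.  With it, E-imc-90 (THEOREM) gives E-imc-84,
and E-imc-83 then gives E-imc-82 (RB66.5, RB66.7). [candidate schema — THEOREM-expected, NOT a tree fact] -/
def FamilyHeckeInputs : Prop :=
  ∀ (m : ℤ) (p : ℕ) [NeZero (4 * p)]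
    (D : ModularParametrizationData (⟨0, -2 * (m : ℚ), 0, (p : ℚ), 0⟩ : WeierstrassCurve ℚ) (4 * p))
    (ℓ : ℕ) (hℓ : ℓ.Prime) (a : ℤ),
    m % 4 = 1 → (p : ℤ) = m ^ 2 + 4 → p.Prime → Odd ℓ → ℓ ≠ p → (a : ℂ) = cuspCoeff D.f ℓ →
      D.f ∈ integralCuspForms0 (4 * p) 2 ∧ cuspCoeff D.f 1 = 1 ∧
        (haveI : NeZero ℓ := ⟨hℓ.ne_zero⟩; heckeT (Gamma0 (4 * p)) 2 ℓ) D.f = (a : ℂ) • D.f ∧ (2 : ℤ) ∣ a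

/-! ### §5. Sanity (`decide`; imc g15 VERBATIM :201–205): the census keys and the `p mod 8` bookkeeping -/

example : (5 % 8 = 5) ∧ (13 % 8 = 5) ∧ (29 % 8 = 5) ∧ (53 % 8 = 5) ∧ (173 % 8 = 5) ∧ (229 % 8 = 5) ∧
    (293 % 8 = 5) ∧ (37 % 8 = 5) ∧ (61 % 8 = 5) ∧ (101 % 8 = 5) ∧ (109 % 8 = 5) ∧ (149 % 8 = 5) := by decide

/-- `m ≡ 1 (mod 4)` (either sign) forces `m² + 4 ≡ 5 (mod 8)`: the family lives in the unramified class. -/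
example : ∀ m : Fin 8, (m.val % 4 = 1 ∨ m.val % 4 = 3) → (m.val ^ 2 + 4) % 8 = 5 := by decide

end Summit.BirchSwinnertonDyer.Rank1Residual.ManinAdditive.TwoEisenstein

end
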